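import Summits.BirchSwinnertonDyer.Rank1Residual.Additive.GordTwistOrdinary
import Summits.BirchSwinnertonDyer.Rank1Residual.Additive.GordDescentCases
import Summits.BirchSwinnertonDyer.Rank1Residual.Additive.QuadraticTwistSurj
import Summits.BirchSwinnertonDyer.Rank1Residual.AdditivePotMult.ModelFreeClassTheorems
import Literature.NumberTheory.EllipticCurves.BSDSelmerCMPConverseKLevelProofs
import Literature.NumberTheory.QuadraticFields.FundamentalDiscriminant
import HarnessLib

/-!
# X3♯(G-ord) / X4♯(G-ord), defect 2: the class theorems MODEL-FREE and DATUM-FREE (I: the twist pair; X4 with surjective `ρ̄`)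

HONEST FRAMING (cell `b2b-bsdres`, run/shared/lean/b2b/bsd-rank1-residual/, verbatim in every
file): the goal of the cell is to DELETE the COMBINATION-SHAPED residual classes of the
Birch–Swinnerton-Dyer formula for ALL analytic-rank `≤ 1` elliptic curves over `ℚ` — "full BSD
formula for every rank `≤ 1` curve in class `C`" assembled STRICTLY from published theorems — so
that the rank-`≤ 1` remainder becomes exactly the CONSTRUCTION-SHAPED classes, which are TYPED
(missing-input `Prop`s), NOT attempted. This is not "finishing BSD". Sub-cell `additive-p2`
(CLASS-OWNERS row "X3/X4 additive — pot. good ordinary / X3♯(G-ord)"), generation 4: research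
route; no claim beyond the stated classes; theorems only, no definition, no new named fact;
X3♯(G-ord)/X4♯(G-ord) stay CONSTRUCTION-SHAPED.

WHAT THIS FILE DOES. The descent theorems of gens 2–3 (`GordDescent.lean`, `GordDescentExact.lean`,
`GordDescentCases.lean`, `GordDescentOneSided.lean`) take three DATA: the quadratic field `K` with
`d_K = p*`, a globally minimal model `Wd ≅ E^{(p*)}` that is good ORDINARY at `p`, and a globally
minimal `K`-model `W'` of `E_K` carrying the over-`K` input `MissingPPartOverAt W' p` (a globally
minimal model over `K` exists only under a class-group condition). Here all three are removed:

* the over-`K` input is additive-p1's MODEL-FREE `MissingPPartOverCAt (W.baseChange K) p`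
  (`AdditivePotMult/ModelFree.lean`: Dokchitser–Dokchitser's `C(E/K)`; Milne 1972 any-model named
  fact `Milne1972.bsdQuotient_baseChange_quadratic_anyModel`) on the CANONICAL model
  `W.baseChange K` — no `K`-model chosen, no class-group condition;
* the quadratic field `K = ℚ(√p*)` is CONSTRUCTED (`exists_quadraticField_discr_pStar`, from the
  tree's `Quadratic.exists_numberField_discr_eq`: `p* ≡ 1 (mod 4)` squarefree), and the over-`K`
  input is quantified over all quadratic `K` with `d_K = p*` (they are isomorphic);
* the good ORDINARY twist is a THEOREM of the theory class on the defect-2 cell (gen 4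
  `GordTwistOrdinary.lean`: `exists_goodOrd_twist_pStar_of_typeGOrd`, `p ≥ 5`), and on X4 with
  `ρ̄_{E,p}` onto (`p ≥ 5`) the BCS row-C2 hypotheses of the twist pair — non-CM, irreducible,
  (im) — are THEOREMS too (`surj_iff_of_model_twist` gen 3, x9's `X9.bigIm_of_surj`, the tree's
  `not_hasCM_of_hasSurjectiveModNGaloisRep_of_five_le` applied to the good-ordinary twist,
  `irr_iff_of_model_twist`).

Results (all `p ≥ 5`, `W` globally minimal, `e = semistabilityIndex W p = 2`):
* `bsdp_twist_pStar_of_classX4_of_surj` / `_cases`, `bsdp_twist_pStar_of_classX3_cases` —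
  `BSD(E^{(p*)}, p)` for the twist pair with the hypotheses placed on `E` (row C2 from surj; all
  cells with the typed X9/X10 resp. X1 inputs of the twist pair).
* **`bsdp_iff_overC_of_classX4Gord_two_of_surj`** — for `(E,p) ∈ X4♯(G-ord) ∩ I₀*` with
  `ρ̄_{E,p}` onto, `r_an(E) ≤ 1`, `r_an(E^{(p*)}) ≤ 1` and ANY quadratic `K` with `d_K = p*`:
  `BSDp W p ↔ MissingPPartOverCAt (W.baseChange K) p`.
* **`bsdp_of_classX4Gord_two_of_surj`** — same rows: `BSD(E,p)` ⇐ the over-`K` input for the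
  quadratic fields of discriminant `p*`, NOTHING ELSE (BCS, Milne any-model, GZK, modularity as
  named published facts). Per-pair hypotheses are exactly: class (theory), `I₀*`, surj,
  `r_an(E) ≤ 1`, `r_an(E^{(p*)}) ≤ 1` (census `TWIST-CENSUS.md`: 369/380 X4 e = 2 pairs have a
  Covered twist; the twist-rank bit fails on 0 of them); `missingPPartAt_of_classX4Gord_two_of_surj`.
The all-cells forms (no surjectivity; X3) and the rank-0 one-sided form are in the sibling
`GordDescentModelFreeCases.lean`.

Located gap UNCHANGED (HOME/b2b-bsdres-additive-p2/AUDIT-X34-GORD.md §2/§4): the over-`K` input at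
the ramified good-ordinary prime ≡ the `ω^{(p−1)/2}`-branch of the cyclotomic main conjecture of
`E^{(p*)}` ≡ Delbourgo's MC (G) — no published source. Nothing here books a pair.

References: A. Burungale, F. Castella, C. Skinner, IMRN 2025 Cor. 1.3.1; J. S. Milne, Invent.
Math. 17 (1972) Thm. 1; T. & V. Dokchitser, Ann. of Math. 172 (2010) §2.1; J.-P. Serre, Invent.
Math. 15 (1972) §4.5, Prop. 12; D. Delbourgo, Compositio Math. 113 (1998) §1.5, p. 151.
-/

noncomputable section

open scoped Classical NumberField

open WeierstrassCurve IsDedekindDomain NumberField Literature.NumberTheory.EllipticCurves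
  Literature.NumberTheory.EllipticCurves.Rank1Residual
  Literature.NumberTheory.EllipticCurves.Rank1Residual.Typed
  Literature.NumberTheory.EllipticCurves.ModularForms
  Literature.NumberTheory.EllipticCurves.Wuthrich2014
  Summit.BirchSwinnertonDyer.Rank1Residual.AdditivePotMult

namespace Summit.BirchSwinnertonDyer.Rank1Residual.Additive

/-! ## §0 The quadratic field `ℚ(√p*)` exists (as a type with `d_K = p*`) -/

/-- `p* = (−1)^{⌊p/2⌋} p` as an integer is `≡ 1 (mod 4)` for odd `p`. -/
theorem pStar_int_emod_four (p : ℕ) [hp : Fact p.Prime] (hp2 : p ≠ 2) :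
    ((-1 : ℤ) ^ (p / 2) * p) % 4 = 1 := by
  have hodd : p % 2 = 1 := Nat.odd_iff.mp (hp.out.odd_of_ne_two hp2)
  rcases Nat.even_or_odd (p / 2) with h | h
  · rw [h.neg_one_pow, one_mul]
    obtain ⟨k, hk⟩ := h
    omega
  · rw [h.neg_one_pow, neg_one_mul]
    obtain ⟨k, hk⟩ := h
    omega

/-- `p*` is squarefree (a unit times a prime). -/
theorem squarefree_pStar_int (p : ℕ) [hp : Fact p.Prime] :
    Squarefree ((-1 : ℤ) ^ (p / 2) * p) := by
  have hsq : Squarefree (p : ℤ) := Int.squarefree_natCast.mpr hp.out.squarefree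
  rcases neg_one_pow_eq_or ℤ (p / 2) with h | h
  · rw [h, one_mul]; exact hsq
  · rw [h, neg_one_mul, ← Int.squarefree_natAbs, Int.natAbs_neg, Int.natAbs_natCast]
    exact hp.out.squarefree

/-- **The quadratic field of discriminant `p*` exists**: for an odd prime `p` there is a quadratic
number field `K` (a `Type`) with `[K:ℚ] = 2` and `d_K = p* = (−1)^{⌊p/2⌋} p` — i.e. `K = ℚ(√p*)`,
the quadratic subfield of `ℚ(ζ_p)` (tree: `Quadratic.exists_numberField_discr_eq` for the
fundamental discriminant `p* ≡ 1 (mod 4)`). [folklore] -/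
theorem exists_quadraticField_discr_pStar (p : ℕ) [hp : Fact p.Prime] (hp2 : p ≠ 2) :
    ∃ (K : Type) (_ : Field K) (_ : NumberField K), Module.finrank ℚ K = 2 ∧
      (NumberField.discr K : ℚ) = (-1 : ℚ) ^ (p / 2) * p := by
  have hne : ((-1 : ℤ) ^ (p / 2) * p) ≠ 1 := by
    intro h
    have h1 := congrArg Int.natAbs h
    rw [Int.natAbs_mul, Int.natAbs_pow, Int.natAbs_neg, Int.natAbs_one, one_pow, one_mul,
      Int.natAbs_natCast] at h1
    exact hp.out.one_lt.ne' (by simpa using h1)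
  obtain ⟨K, iF, iN, h2, hd⟩ :=
    Literature.NumberTheory.QuadraticFields.Quadratic.exists_numberField_discr_eq
      (D := (-1 : ℤ) ^ (p / 2) * p) (Or.inl ⟨pStar_int_emod_four p hp2, squarefree_pStar_int p, hne⟩)
  exact ⟨K, iF, iN, h2, by rw [hd]; push_cast; ring⟩

variable (W : WeierstrassCurve ℚ) [W.IsElliptic] [W.IsGloballyMinimal] (p : ℕ) [hp : Fact p.Prime]

/-! ## §1 `BSD(E^{(p*)}, p)` for the twist pair — hypotheses placed on `E` -/

section TwistPair

variable (Wd : WeierstrassCurve ℚ) [Wd.IsElliptic] [Wd.IsGloballyMinimal]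

omit [W.IsGloballyMinimal] in
/-- **Row C2 for the twist pair from surj(p) on `E`** (`p ≥ 5`): for `(E,p) ∈ X4` with `ρ̄_{E,p}`
onto and a globally minimal `Wd ≅ E^{(p*)}` good ordinary at `p`, the pair `(Wd, p)` is row C2 —
surjectivity transports to the twist (`surj_iff_of_model_twist`), gives (im) (`X9.bigIm_of_surj`)
and, at the good ORDINARY prime `p ≥ 5` of the twist, non-CM
(`not_hasCM_of_hasSurjectiveModNGaloisRep_of_five_le`, Serre 1972 §4.5); irreducibility from X4
(`irr_iff_of_model_twist`). [cite: Serre1972, §4.5] -/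
theorem rowC2_twist_pStar_of_classX4_of_surj (hp5 : 5 ≤ p) (hX : ClassX4 W p) (hsurj : Surj W p)
    (hWd : ∃ C : VariableChange ℚ, C • W.quadraticTwist ((-1 : ℚ) ^ (p / 2) * p) = Wd)
    (hord : GoodOrd Wd p) : RowC2 Wd p := by
  have hsurjd : Surj Wd p := (surj_iff_of_model_twist W p (pStar_ne_zero p) hWd).mpr hsurj
  exact ⟨not_hasCM_of_hasSurjectiveModNGaloisRep_of_five_le Wd p hp5 hord.1 hord.2 hsurjd, by omega,
    hord, (irr_iff_of_model_twist (pStar_ne_zero p) hWd).mpr hX.2.2, X9.bigIm_of_surj Wd p hp5 hsurjd⟩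

omit [W.IsGloballyMinimal] in
/-- **`BSD(E^{(p*)}, p)` for the twist pair of an X4 pair with surjective `ρ̄_{E,p}`** (`p ≥ 5`,
twist good ordinary, `r_an(E^{(p*)}) ≤ 1`): Burungale–Castella–Skinner 2025 Cor. 1.3.1 (`hBCS`,
row C2) with GZK. [cite: BurungaleCastellaSkinner2025, Cor. 1.3.1 (p. 4)] -/
theorem bsdp_twist_pStar_of_classX4_of_surj
    (hGZK : rank_eq_analyticRank_of_analyticRank_le_one)
    (hBCS : BurungaleCastellaSkinner2025.cor131_padicValRat_bsd_rank_le_one)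
    (hp5 : 5 ≤ p) (hX : ClassX4 W p) (hsurj : Surj W p)
    (hWd : ∃ C : VariableChange ℚ, C • W.quadraticTwist ((-1 : ℚ) ^ (p / 2) * p) = Wd)
    (hord : GoodOrd Wd p) (hrd : Wd.analyticRank ≤ 1) : BSDp Wd p :=
  RowC2.bsdp hBCS hGZK hrd (rowC2_twist_pStar_of_classX4_of_surj W p Wd hp5 hX hsurj hWd hord)

omit [W.IsGloballyMinimal] in
/-- **`BSD(E^{(p*)}, p)` for the twist pair of an X4 pair, all cells** (`p` odd, twist good
ordinary of analytic rank `≤ 1`): Covered (rows C2/C8/C10/…: the fourteen published facts of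
`bsdp_of_covered`) or — failing (im) — the typed X9 / X10 input of the twist pair
(`covered_or_cases_of_goodOrd_twist`; X1/X12 excluded by irreducibility / non-CM). Extracted from
gen 2's `bsdp_of_classX4_of_goodOrd_twist_cases`. -/
theorem bsdp_twist_pStar_of_classX4_cases (hSk : Skinner2016.thmC_padicValRat_bsd_rank_zero)
    (hBCS : BurungaleCastellaSkinner2025.cor131_padicValRat_bsd_rank_le_one)
    (hJSW : JetchevSkinnerWan2017.thm121_padicValRat_bsd_rank_one)
    (hCGS : CastellaGrossiSkinner2025.thmD_padicValRat_bsd_rank_le_one)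
    (hGV : GreenbergVatsal2000.thm13_charIdeal_eq_of_gvPar) (hGr : greenberg_charValue_rankZero)
    (hmod : hasEntireLFunction_rat) (hmodP : nonempty_modularParametrizationData)
    (hGZK : rank_eq_analyticRank_of_analyticRank_le_one)
    (hCM : bsdTriple_of_hasCM_of_L_one_ne_zero) (hKob : Kobayashi2013.cor14_bsdp_of_cm_rank_one)
    (hYZ : YanZhu2026.thm415_padicValRat_bsd_rank_le_one)
    (hW20 : Wuthrich2014.lemma20_surjective_threeAdic_of_semistable)
    (hLLT : LiLiuTian2024.thm11_bsdp_of_cm_rank_one)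
    (hX : ClassX4 W p)
    (hWd : ∃ C : VariableChange ℚ, C • W.quadraticTwist ((-1 : ℚ) ^ (p / 2) * p) = Wd)
    (hord : GoodOrd Wd p) (hrd : Wd.analyticRank ≤ 1)
    (hX9 : ClassX9 Wd p → X9.MissingInputAt Wd p) (hX10 : ClassX10 Wd p → X10.MissingInputAt Wd) :
    BSDp Wd p := by
  have hirr : Irr Wd p := (irr_iff_of_model_twist (pStar_ne_zero p) hWd).mpr hX.2.2
  by_cases hcmd : Wd.HasCM
  · refine bsdp_of_covered hSk hBCS hJSW hCGS hGV hGr hmod hmodP hGZK hCM hKob hYZ hW20 hLLT hrd ?_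
    rcases Nat.le_one_iff_eq_zero_or_eq_one.mp hrd with h0 | h1
    · exact Or.inr (Or.inr (Or.inr (Or.inr (Or.inr (Or.inl ⟨hcmd, h0⟩)))))
    · exact Or.inr (Or.inr (Or.inr (Or.inr (Or.inr (Or.inr (Or.inl ⟨hcmd, h1, hX.1, hord.1⟩))))))
  rcases covered_or_cases_of_goodOrd_twist p Wd hX.1 hord hrd with hc | h1 | h9 | h9im | h10 | h12
  · exact bsdp_of_covered hSk hBCS hJSW hCGS hGV hGr hmod hmodP hGZK hCM hKob hYZ hW20 hLLT hrd hc
  · exact absurd hirr h1.2.1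
  · exact X9.bsdp_of_missingInputAt hGZK Wd p hrd h9 (hX9 h9)
  · have h9 : ClassX9 Wd p := (classX9im_iff_classX9 Wd p).mp h9im
    exact X9.bsdp_of_missingInputAt hGZK Wd p hrd h9 (hX9 h9)
  · exact X10.bsdp_of_missingInputAt hYZ hGZK hmod hW20 Wd p hrd h10 (hX10 h10)
  · exact absurd h12.1 hcmd

omit [W.IsGloballyMinimal] in
/-- **`BSD(E^{(p*)}, p)` for the twist pair of an X3 pair** (`p` odd, twist good ordinary of
analytic rank `≤ 1`): the pair is Covered (CM rows C8/C10, non-anomalous row C6, rank-0 GV row C7)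
or of class X1, where the cell's typed X1 input is taken (`covered_or_classX1_twist_of_classX3`;
Wuthrich Prop. 21 `hW` inside `X1.bsdp_of_missingInputAt`). [cite: Wuthrich2014, Prop. 21 (p. 400)] -/
theorem bsdp_twist_pStar_of_classX3_cases (hSk : Skinner2016.thmC_padicValRat_bsd_rank_zero)
    (hBCS : BurungaleCastellaSkinner2025.cor131_padicValRat_bsd_rank_le_one)
    (hJSW : JetchevSkinnerWan2017.thm121_padicValRat_bsd_rank_one)
    (hCGS : CastellaGrossiSkinner2025.thmD_padicValRat_bsd_rank_le_one)
    (hGV : GreenbergVatsal2000.thm13_charIdeal_eq_of_gvPar) (hGr : greenberg_charValue_rankZero)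
    (hmod : hasEntireLFunction_rat) (hmodP : nonempty_modularParametrizationData)
    (hGZK : rank_eq_analyticRank_of_analyticRank_le_one)
    (hCM : bsdTriple_of_hasCM_of_L_one_ne_zero) (hKob : Kobayashi2013.cor14_bsdp_of_cm_rank_one)
    (hYZ : YanZhu2026.thm415_padicValRat_bsd_rank_le_one)
    (hW20 : Wuthrich2014.lemma20_surjective_threeAdic_of_semistable)
    (hLLT : LiLiuTian2024.thm11_bsdp_of_cm_rank_one) (hW : sha_dvd_analyticSha)
    (hX : ClassX3 W p) (hp2 : p ≠ 2)
    (hWd : ∃ C : VariableChange ℚ, C • W.quadraticTwist ((-1 : ℚ) ^ (p / 2) * p) = Wd)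
    (hord : GoodOrd Wd p) (hrd : Wd.analyticRank ≤ 1)
    (hX1 : ClassX1 Wd p → X1.MissingInputAt Wd p) : BSDp Wd p := by
  rcases covered_or_classX1_twist_of_classX3 W p Wd hp2 hX hWd hord hrd with hc | h1
  · exact bsdp_of_covered hSk hBCS hJSW hCGS hGV hGr hmod hmodP hGZK hCM hKob hYZ hW20 hLLT hrd hc
  · exact X1.bsdp_of_missingInputAt hW hGZK hmod Wd p hrd h1 (hX1 h1)

end TwistPair

/-! ## §2 X4♯(G-ord) ∩ I₀*, `p ≥ 5`, surjective `ρ̄`: model-free, datum-free -/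

section X4

/-- **Exact relocation, model-free (X4♯(G-ord) ∩ I₀*, `p ≥ 5`, surj).** For `(E,p) ∈ X4♯(G-ord)`
(`ClassX4Gord W p`) of semistability index `2`, `ρ̄_{E,p}` onto, `r_an(E) ≤ 1`, `r_an(E^{(p*)}) ≤ 1`
(stated on the model `W^{(p*)}`; an isomorphism invariant, `analyticRank_smul`), and ANY quadratic
field `K` with `d_K = p*`: **`BSDp W p ↔ MissingPPartOverCAt (W.baseChange K) p`** — Miller's
`BSD(E,p)` is EXACTLY the `p`-part of BSD for `E_K` on the canonical base-changed model (D–D's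
`C(E/K)`). The good-ordinary twist is produced from the class (`exists_goodOrd_twist_pStar_of_typeGOrd`),
its `BSD(·,p)` is row C2 (`bsdp_twist_pStar_of_classX4_of_surj`), the equivalence is additive-p1's
`missingPPartOverCAt_baseChange_iff_bsdp` (Milne any-model `hMilneC`, GZK, modularity).
[cite: BurungaleCastellaSkinner2025, Cor. 1.3.1 (p. 4)] -/
theorem bsdp_iff_overC_of_classX4Gord_two_of_surj
    (hGZK : rank_eq_analyticRank_of_analyticRank_le_one) (hmod : hasEntireLFunction_rat)
    (hMilneC : Milne1972.bsdQuotient_baseChange_quadratic_anyModel)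
    (hBCS : BurungaleCastellaSkinner2025.cor131_padicValRat_bsd_rank_le_one)
    (hp5 : 5 ≤ p) (hX : ClassX4Gord W p) (he : semistabilityIndex W p = 2) (hsurj : Surj W p)
    (hr : W.analyticRank ≤ 1)
    (hrd : (W.quadraticTwist ((-1 : ℚ) ^ (p / 2) * p)).analyticRank ≤ 1)
    (K : Type) [Field K] [NumberField K] (h2 : Module.finrank ℚ K = 2)
    (hdK : (NumberField.discr K : ℚ) = (-1 : ℚ) ^ (p / 2) * p) :
    BSDp W p ↔ MissingPPartOverCAt (W.baseChange K) p := by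
  obtain ⟨Wd, iWd, iWdm, C, hC, hord⟩ := exists_goodOrd_twist_pStar_of_typeGOrd W p hp5 hX.typeGOrd he
  haveI := W.isElliptic_quadraticTwist (pStar_ne_zero p)
  have hrd' : Wd.analyticRank ≤ 1 := by rw [← hC, analyticRank_smul]; exact hrd
  have hWdK : ∃ C : VariableChange ℚ, C • W.quadraticTwist (NumberField.discr K : ℚ) = Wd := by
    rw [hdK]; exact ⟨C, hC⟩
  have hd : BSDp Wd p :=
    bsdp_twist_pStar_of_classX4_of_surj W p Wd hGZK hBCS hp5 hX.classX4 hsurj ⟨C, hC⟩ hord hrd'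
  exact (missingPPartOverCAt_baseChange_iff_bsdp W p K Wd hGZK hmod hMilneC hr h2 hWdK hrd' hd).symm

/-- **X4♯(G-ord) ∩ I₀*, `p ≥ 5`, `ρ̄_{E,p}` onto — `BSD(E,p)` from the over-`K` input ALONE,
model-free and datum-free.** For `(E,p) ∈ X4♯(G-ord)` with `e = 2`, `Surj W p`, `r_an(E) ≤ 1` and
`r_an(E^{(p*)}) ≤ 1`: if `MissingPPartOverCAt (W.baseChange K) p` holds for the quadratic fields
`K` of discriminant `p*` (there is one: `exists_quadraticField_discr_pStar`), then `BSD(E,p)`. The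
other inputs are PUBLISHED theorems as the cell's named facts (BCS 2025 Cor. 1.3.1 `hBCS`, Milne
1972 any-model `hMilneC`, GZK `hGZK`, modularity `hmod`). The over-`K` input — `p`-part of BSD for
`E_K` at the ramified prime of GOOD ORDINARY reduction — is reached by no published theorem
(module docstring). [cite: BurungaleCastellaSkinner2025, Cor. 1.3.1 (p. 4)] -/
theorem bsdp_of_classX4Gord_two_of_surj
    (hGZK : rank_eq_analyticRank_of_analyticRank_le_one) (hmod : hasEntireLFunction_rat)
    (hMilneC : Milne1972.bsdQuotient_baseChange_quadratic_anyModel)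
    (hBCS : BurungaleCastellaSkinner2025.cor131_padicValRat_bsd_rank_le_one)
    (hp5 : 5 ≤ p) (hX : ClassX4Gord W p) (he : semistabilityIndex W p = 2) (hsurj : Surj W p)
    (hr : W.analyticRank ≤ 1)
    (hrd : (W.quadraticTwist ((-1 : ℚ) ^ (p / 2) * p)).analyticRank ≤ 1)
    (hK : ∀ (K : Type) [Field K] [NumberField K], Module.finrank ℚ K = 2 →
      (NumberField.discr K : ℚ) = (-1 : ℚ) ^ (p / 2) * p → MissingPPartOverCAt (W.baseChange K) p) :
    BSDp W p := by
  obtain ⟨K, iF, iN, h2, hdK⟩ := exists_quadraticField_discr_pStar p (by omega)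
  exact (bsdp_iff_overC_of_classX4Gord_two_of_surj W p hGZK hmod hMilneC hBCS hp5 hX he hsurj hr hrd
    K h2 hdK).mpr (hK K h2 hdK)

/-- The same in the cell's `MissingPPartAt` / `Gord.MissingInputAt` currency: on these rows the
sub-cell's typed input over `ℚ` FOLLOWS from the over-`K` input (and conversely, by
`bsdp_iff_overC_of_classX4Gord_two_of_surj`). [cite: BurungaleCastellaSkinner2025, Cor. 1.3.1 (p. 4)] -/
theorem missingPPartAt_of_classX4Gord_two_of_surj
    (hGZK : rank_eq_analyticRank_of_analyticRank_le_one) (hmod : hasEntireLFunction_rat)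
    (hMilneC : Milne1972.bsdQuotient_baseChange_quadratic_anyModel)
    (hBCS : BurungaleCastellaSkinner2025.cor131_padicValRat_bsd_rank_le_one)
    (hp5 : 5 ≤ p) (hX : ClassX4Gord W p) (he : semistabilityIndex W p = 2) (hsurj : Surj W p)
    (hr : W.analyticRank ≤ 1)
    (hrd : (W.quadraticTwist ((-1 : ℚ) ^ (p / 2) * p)).analyticRank ≤ 1)
    (hK : ∀ (K : Type) [Field K] [NumberField K], Module.finrank ℚ K = 2 →
      (NumberField.discr K : ℚ) = (-1 : ℚ) ^ (p / 2) * p → MissingPPartOverCAt (W.baseChange K) p) :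
    MissingPPartAt W p := by
  haveI : Finite W.sha := (hGZK W hr).2
  exact missingPPartAt_of_bsdp W p
    (bsdp_of_classX4Gord_two_of_surj W p hGZK hmod hMilneC hBCS hp5 hX he hsurj hr hrd hK)

end X4

end Summit.BirchSwinnertonDyer.Rank1Residual.Additive

end
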